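import Summits.CriticalPhenomena.Ising3DConformalLimit.Theses.MoebiusRestrictionCurrents
import Literature.Probability.LatticeModels.CriticalCorrWellDefined

/-!
# `FreeIsCritical` — the free-boundary box limit at `β_c(3)` is the critical correlator

Route `route-CriticalPhenomena-MoebiusRestrictionCurrents`, item `stmt-CriticalPhenomena-4857`.

The support item asks: for every `n` and every `y : Fin n → ℤ³`,
`⟨∏ᵢ σ_{yᵢ}⟩^free_{B(L); β_c(3), 0} → criticalCorr 3 n y` as `L → ∞`.

This is, after unfolding `HasBoxLimit`, the `bc = free` instance of the named fact
`Literature.Probability.LatticeModels.criticalCorr_wellDefined` (crit-ising.S09) at `d = 3`, which is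
a theorem of the tree: `Literature.Probability.LatticeModels.criticalCorr_wellDefined_holds`
(`CriticalCorrWellDefined.lean`; ingredients: GKS box limits of the free and plus states,
the Lebowitz–Martin-Löf / Friedli–Velenik Thm. 3.28 identification `⟨σ_A⟩^∅ = ⟨σ_A⟩⁺` when
`m*(β) = 0`, and `m*(β_c) = 0` for `d ≥ 3`, Aizenman–Duminil-Copin–Sidoravicius 2015).
No new mathematics is needed here.
-/

namespace Summit.CriticalPhenomena.Ising3DConformalLimit.Theorems

open Filter Topology Literature.Probability.LatticeModels
open Summit.CriticalPhenomena.Ising3DConformalLimit.Theses.MoebiusRestrictionCurrents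

/-- **Support item `stmt-CriticalPhenomena-4857` (`FreeIsCritical`).** At `β_c(3)` and zero field the
free-boundary box expectations of every spin monomial converge to the critical (plus-state)
correlator: `⟨∏ᵢ σ_{yᵢ}⟩^free_{B(L); β_c, 0} → criticalCorr 3 n y` as `L → ∞`. Immediate from the tree
theorem `criticalCorr_wellDefined_holds` (Friedli–Velenik 2017, Thm. 3.17, Lemma 3.23, Thm. 3.28;
Aizenman–Duminil-Copin–Sidoravicius 2015, Thm. 1.2 / Cor. 1.5) specialised to `d = 3` and the free
boundary condition. -/
theorem freeIsCritical_proof :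
    Summit.CriticalPhenomena.Ising3DConformalLimit.Theses.MoebiusRestrictionCurrents.FreeIsCritical := by
  unfold FreeIsCritical
  intro n y
  exact criticalCorr_wellDefined_holds (d := 3) le_rfl n y .free (by simp)

end Summit.CriticalPhenomena.Ising3DConformalLimit.Theorems
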